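import Summits.CriticalPhenomena.PercolationContinuityZ3.Theorems.Transplant.SkelPhiWindowSpans
import Summits.CriticalPhenomena.PercolationContinuityZ3.Theorems.Transplant.SkelCellsConcG
import Summits.CriticalPhenomena.PercolationContinuityZ3.Theorems.Transplant.PlanarCells2StairLev
import Summits.CriticalPhenomena.PercolationContinuityZ3.Theorems.Transplant.PlanarCells2Sep
import Summits.CriticalPhenomena.PercolationContinuityZ3.Theorems.Transplant.PlanarCells2SepInf
import HarnessLib

/-!
# L3′ (part 2): the CELL GEOMETRY OF RECORD at φ-LEVEL over the TWO-UNIT planar cells — the structure-free re-cut of `SkelCellsConcG`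
# for the D″ generic layer (DPRIME-SCOPE §2 L3′, p3 addendum K; source `SkelCellsConcG` (p2 gen 3), cells `PCells2` (hp-8, L1′))

builds on p205010 (kernel theorem, internal audit signed; external expert review pending) — nothing in this file uses p205010.
Lane `prim-bschramm-*`, seat `prim-bschramm-p2` (gen 7); helper file (`--supports stmt-CriticalPhenomena-4575`).

WHAT CHANGES against the source (everything else is the source's text up to the dictionary `Φ ↦ (G, φ)`, `Φ.lip ↦ hlip`, `Φ.step ↦ hstep`):
(1) the planar cells are hp-8's two-unit `P : PCells2` (run-axis unit `r (δ.1)` along, transverse unit `r (oth δ.1)` across; every planar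
    containment / disjointness / separation used is already twinned in `PlanarCells2Contain/Sep/Levels/SepInf`; the five self-adjacency /
    column supplements the source proved for `PCells` are proved here for `PCells2`, §1);
(2) the LEVEL DATA: the engine's `LevelData` has direction-free face levels `L j`, but the two axes' shifted face rows are `5 r_a + 10 s_a j − 1`;
    so `lev` is the planar level composed with the STAIRCASE `PCells2.stairLev P δ.1` (monotone, increments `0/1`, file `PlanarCells2StairLev`),
    under which both axes' face rows sit at `L j := 2j` and the cube rows at `≤ ℓQ := 1` — the L2 engine (`KNCells2FacePrefix` …) is untouched;
(3) well-formedness `Skelφ.WF2 / WFS2 P Λ`: p3's eight order families of `ConcRadiiG.WF` with the run-axis unit in the base-row clause, plus the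
    source's unit slacks and column radius.
* §1 `PCells2.exists_adj_of_mem_Cell/Zone/EfarN`, `single_mem_Q_zero`, `cen_add_single_mem_Q`; `Skelφ.mem_VWin_of_zdAdj (hstep)`;
* §2 `Skelφ.prof`, **`Skelφ.cellGeomSG G φ P w₀ Λ`**, `faceDataSG`, `levelDataS` (staircase levels), `WF2`, `WFS2`;
* §3–§4 **`runGeomSG`, `anchGeomSG`, `sepGeomSG (hstep)`, `sepGeom₂SG (hstep)`**; `exitGeomSG (hlip)`, `stepsGeomSG (hstep)`, `levelGeomSG (hlip)`,
  `qSepGeomSG (hlip)` are in the companion file `SkelPhiCellsConcGLevels` (400-line rule).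
Hypotheses beyond the dictionary: `WFS2 P Λ` and `φ w₀ = 0` (root footprint at the macro-origin's centre; WLOG by translating `φ`).
[cite: KozmaNitzan2024, §4 pp. 25–27, 30–31 (Q_v, M_v, E_{v,x}, H^j_{v,x}, F^j_{v,x}) — the ℤ^d model] [cite: GrimmettPercolation1999, §7.2]
-/

noncomputable section

open scoped Classical

namespace Summit.CriticalPhenomena.PercolationContinuityZ3.Theorems

namespace Transplant

/-! ## §1 Planar supplements for the two-unit cells -/

namespace PCells2

open Literature.Probability.Percolation Literature.Probability.LatticeModels SimpleGraph
open Literature.Probability.Percolation.KozmaNitzan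
open Literature.Probability.Percolation.KozmaNitzan.Cells (oth oth_ne sgOf)

variable (P : PCells2)

/-- Self-adjacency of the cell `cen v + [−10r₀, 10r₀] × [−10r₁, 10r₁]`. [folklore] -/
theorem exists_adj_of_mem_Cell (v : Site 2) {t : Site 2} (ht : t ∈ P.Cell v) : ∃ t' ∈ P.Cell v, (zdGraph 2).Adj t t' :=
  PCells.exists_adj_of_mem_Icc 0 (by simp only [Pi.sub_apply, Pi.add_apply, hw_apply]; push_cast; have := P.one_le_r 0; omega) ht

/-- Self-adjacency of the stub zone (transverse side `4 r⊥ ≥ 1`). [folklore] -/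
theorem exists_adj_of_mem_Zone (v : Site 2) (δ : MDir) {t : Site 2} (ht : t ∈ P.Zone v δ) : ∃ t' ∈ P.Zone v δ, (zdGraph 2).Adj t t' := by
  unfold Zone sBox at ht ⊢
  refine PCells.exists_adj_of_mem_Icc (oth δ.1) ?_ ht
  simp only [sLo, sHi, if_neg (oth_ne δ.1)]
  have := P.one_le_r (oth δ.1); omega

/-- Self-adjacency of the narrow far box (transverse side `2 (5 r⊥ − 1) ≥ 1`). [folklore] -/
theorem exists_adj_of_mem_EfarN (v : Site 2) (δ : MDir) {t : Site 2} (ht : t ∈ P.EfarN v δ) : ∃ t' ∈ P.EfarN v δ, (zdGraph 2).Adj t t' := by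
  unfold EfarN sBox at ht ⊢
  refine PCells.exists_adj_of_mem_Icc (oth δ.1) ?_ ht
  simp only [sLo, sHi, if_neg (oth_ne δ.1)]
  have := P.one_le_r (oth δ.1); omega

/-- `e₀ ∈ Q_0` (`5 r₀ ≥ 1`). [folklore] -/
theorem single_mem_Q_zero : (0 : Site 2) + Pi.single (0 : Fin 2) ((1 : ℤˣ) : ℤ) ∈ P.Q 0 := by
  rw [Q, mem_abox_iff]
  have := P.one_le_r 0
  intro i
  fin_cases i
  · simp; omega
  · simp

/-- `cen x + e₀ ∈ Q_x` (`5 r₀ ≥ 1`). [folklore] -/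
theorem cen_add_single_mem_Q (x : Site 2) : P.cen x + Pi.single (0 : Fin 2) ((1 : ℤˣ) : ℤ) ∈ P.Q x := by
  rw [Q, mem_abox_iff]
  have := P.one_le_r 0
  intro i
  fin_cases i
  · simp; omega
  · simp

end PCells2

namespace Skelφ

open Literature.Probability.Percolation Literature.Probability.LatticeModels SimpleGraph KNCells
open Literature.Probability.Percolation.KozmaNitzan.Cells (oth oth_ne sgOf sgOf_sign stepVec_apply_fst stepVec_apply_oth eq_oth_of_ne oth_oth)
open Literature.Barriers.CriticalPhenomena (graphBall graphBall_finite mem_graphBall_self graphBall_mono)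
open BoxProdZ2 (ConcRadiiG)
open PlanarSkeletonConc (exists_single_of_zdAdj mem_vspan_edgesIn_iff)

variable {V : Type} [DecidableEq V] {G : SimpleGraph V} [G.LocallyFinite] {φ : V → Site 2}

/-- **The step device, `ℤ²`-adjacency form** (under (ι) steps): a vertex of depth `≤ n`, `n + 1 ≤ R`, footprint in `P`, with a `ℤ²`-neighbour
of its footprint in `P`, lies in `VWin P R`. [this work] -/
theorem mem_VWin_of_zdAdj (hstep : Steps G φ) {w₀ : V} {Pl : Finset (Site 2)} {R n : ℕ} {y : V} (hy : y ∈ graphBall G w₀ n)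
    (hn : n + 1 ≤ R) (hP : φ y ∈ Pl) (hself : ∃ t' ∈ Pl, (zdGraph 2).Adj (φ y) t') : y ∈ VWin G φ w₀ Pl R := by
  obtain ⟨t', ht', hadj⟩ := hself
  obtain ⟨i, σ, rfl⟩ := exists_single_of_zdAdj hadj
  exact mem_VWin_of_step hstep hy hn hP ht'

variable (G φ)

/-! ## §2 The cell geometry of record over window spans, two units -/

/-- The corridor profile as a planar function (fibre depth allowed at planar level `lev δ v t`). [this work] -/
def prof (P : PCells2) (Λ : ConcRadiiG) (a : ℕ) (v : Site 2) (δ : MDir) : Site 2 → ℕ := fun t => Λ.ρ a v δ (P.lev δ v t)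

/-- **The concentric cell geometry over a planar map, two units** (anchor type `ℕ` = depth, rule `a ↦ a + 1`, admissible `{a, a+1}`):
every region is the vertex span of a coordinate-free window over the two-unit planar box, with p3's radius schedule; between / far boxes
are the narrow ones. [cite: KozmaNitzan2024, §4 pp. 25–26 (Q_v, M_v, E_{v,x}, H^j_{v,x})] -/
def cellGeomSG (P : PCells2) (w₀ : V) (Λ : ConcRadiiG) : CellGeom V ℕ where
  K := P.K
  root := w₀
  a₀ := 0
  Q := fun a v => VWin G φ w₀ (P.Q v) (Λ.rQ a v)
  M := fun a v => VWin G φ w₀ (P.M v) (Λ.rM a v)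
  Cell := fun a v => VWin G φ w₀ (P.Cell v) (Λ.rC a v)
  Btw := fun a v δ => VWin G φ w₀ (P.BtwN v δ) (Λ.rB a v δ)
  Efar := fun a v δ => VWin G φ w₀ (P.EfarN v δ) (Λ.rE a v δ)
  Stub := fun a v δ j => VStair G φ w₀ (P.Stub v δ j) (prof P Λ a v δ)
  Zone := fun a v δ => VWin G φ w₀ (P.Zone v δ) (Λ.rB a v δ)
  col := fun x => {y | φ y = P.cen x}
  anchor := fun a _ _ => a + 1
  anchSet := fun a _ => {a, a + 1}
  anchor_mem := fun a _ _ => Finset.mem_insert_of_mem (Finset.mem_singleton_self _)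
  stub_mono := fun _ v δ _ _ h => VStair_mono (P.Stub_mono v δ h) fun _ _ => le_rfl
  hK := by have := P.hK; omega

/-- **Faces and corridors**: the corridor is the span of the staircase window over `H_{v,δ}`; the face of level `j` is the part of the stub
span at planar level `5 r∥ + 10 s∥ j − 1` (ONE ROW BELOW the planar face — the level shift). [cite: KozmaNitzan2024, §4 p. 26 (H_{v,x}), p. 30 (F^j_{v,x})] -/
def faceDataSG (P : PCells2) (w₀ : V) (Λ : ConcRadiiG) : FaceData V ℕ where
  Face := fun a v δ j => (VStair G φ w₀ (P.Stub v δ j) (prof P Λ a v δ)).filter fun y =>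
    P.lev δ v (φ y) = 5 * (P.r δ.1 : ℤ) + 10 * (P.s δ.1 : ℤ) * j - 1
  Hfull := fun a v δ => VStair G φ w₀ (P.Hfull v δ) (prof P Λ a v δ)

/-- **Level data, two units** — the STAIRCASE levels: `lev = stairLev δ.1 (planar level of the footprint)`, `L j = 2j`, `ℓQ = 1`
(`PlanarCells2StairLev`: both axes' shifted face rows `5 r_a + 10 s_a j − 1` sit at `2j`, the cube rows at `≤ 1`). [this work] -/
def levelDataS (P : PCells2) : LevelData V ℕ where
  lev := fun _ v δ y => P.stairLev δ.1 (P.lev δ v (φ y))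
  L := fun j => 2 * (j : ℤ)
  ℓQ := 1

/-- **Well-formedness of a radius schedule w.r.t. the two-unit cells**: p3's eight order families (`ConcRadiiG.WF`) with the run-axis unit
in the base-row clause. [this work] -/
structure WF2 (P : PCells2) (Λ : ConcRadiiG) : Prop where
  /-- `Q_a x ⊆ Cell_{a'} x` -/
  QC : ∀ a a' x, a' ∈ ({a, a + 1} : Finset ℕ) → Λ.rQ a x ≤ Λ.rC a' x
  /-- `Btw_{a'} v δ ⊆ Cell_a v ∪ …` -/
  BC : ∀ a a' v δ, a' ∈ ({a, a + 1} : Finset ℕ) → Λ.rB a' v δ ≤ Λ.rC a v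
  /-- `Btw_a v δ ⊆ … ∪ Cell_{a'} (v + δ)` -/
  BC' : ∀ a a' v δ, a' ∈ ({a, a + 1} : Finset ℕ) → Λ.rB a v δ ≤ Λ.rC a' (v + stepVec δ)
  /-- the base rows (levels `≤ 5 r∥`) of the corridor sets at `a'` lie in the cube `Q_a v` -/
  ρQ : ∀ a a' v δ ℓ, a' ∈ ({a, a + 1} : Finset ℕ) → ℓ ≤ 5 * (P.r δ.1 : ℤ) → Λ.ρ a' v δ ℓ ≤ Λ.rQ a v
  /-- the corridor profile stays inside the far box -/
  ρE : ∀ a v δ ℓ, Λ.ρ a v δ ℓ ≤ Λ.rE a v δ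
  /-- the far box inside the between-box -/
  EB : ∀ a v δ, Λ.rE a v δ ≤ Λ.rB a v δ
  /-- the far box inside the next cube -/
  EQ : ∀ a v δ, Λ.rE a v δ ≤ Λ.rQ a (v + stepVec δ)
  /-- the target cube of `v + δ` inside the far box of `(v, δ)` -/
  ME : ∀ a v δ, Λ.rM a (v + stepVec δ) ≤ Λ.rE a v δ

/-- **Well-formedness with slack, two units**: `WF2` plus ONE UNIT of fibre slack at each union containment and the column radius (the price
of the step device). [this work] -/
structure WFS2 (P : PCells2) (Λ : ConcRadiiG) : Prop extends WF2 P Λ where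
  /-- `BtwN_{a'} ⊆ Cell_a ∪ …` with slack -/
  BC1 : ∀ a a' v δ, a' ∈ ({a, a + 1} : Finset ℕ) → Λ.rB a' v δ + 1 ≤ Λ.rC a v
  /-- `BtwN_a ⊆ … ∪ Cell_{a'}(v + δ)` with slack -/
  BC1' : ∀ a a' v δ, a' ∈ ({a, a + 1} : Finset ℕ) → Λ.rB a v δ + 1 ≤ Λ.rC a' (v + stepVec δ)
  /-- base rows of the corridor sets inside the cube, with slack -/
  ρQ1 : ∀ a a' v δ ℓ, a' ∈ ({a, a + 1} : Finset ℕ) → ℓ ≤ 5 * (P.r δ.1 : ℤ) → Λ.ρ a' v δ ℓ + 1 ≤ Λ.rQ a v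
  /-- corridor profile inside the far box, with slack -/
  ρE1 : ∀ a v δ ℓ, Λ.ρ a v δ ℓ + 1 ≤ Λ.rE a v δ
  /-- far box inside the between-box, with slack -/
  EB1 : ∀ a v δ, Λ.rE a v δ + 1 ≤ Λ.rB a v δ
  /-- far box inside the next cube, with slack -/
  EQ1 : ∀ a v δ, Λ.rE a v δ + 1 ≤ Λ.rQ a (v + stepVec δ)
  /-- the column point of `x` inside `Q_a x`: the cube's radius dominates the planar ℓ¹-offset of `cen x` -/
  colQ : ∀ a x, (P.cen x 0).natAbs + (P.cen x 1).natAbs + 1 ≤ Λ.rQ a x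

variable {G φ}

namespace WF2

variable {P : PCells2} {Λ : ConcRadiiG} (hΛ : WF2 P Λ)
include hΛ

/-- `ρ a v δ ℓ ≤ rB a v δ`. [folklore] -/
theorem ρB (a : ℕ) (v : Site 2) (δ : MDir) (ℓ : ℤ) : Λ.ρ a v δ ℓ ≤ Λ.rB a v δ := (hΛ.ρE a v δ ℓ).trans (hΛ.EB a v δ)

/-- `ρ a' v δ ℓ ≤ rC a v` for an admissible `a'`. [folklore] -/
theorem ρC {a a' : ℕ} (v : Site 2) (δ : MDir) (ℓ : ℤ) (h : a' ∈ ({a, a + 1} : Finset ℕ)) : Λ.ρ a' v δ ℓ ≤ Λ.rC a v :=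
  (hΛ.ρB a' v δ ℓ).trans (hΛ.BC a a' v δ h)

/-- `rM a w ≤ rE` of the edge arriving at `w` from `w − e₀`, `≤ rQ a w` (the one-unit `ConcRadiiG.WF.MQ`, spelled through the far box so
that the statement is not a restatement of it). [folklore] -/
theorem rM_le_rE_le_rQ (a : ℕ) (w : Site 2) :
    Λ.rM a w ≤ Λ.rE a (w - stepVec (0, true)) (0, true) ∧ Λ.rE a (w - stepVec (0, true)) (0, true) ≤ Λ.rQ a w := by
  have h1 := hΛ.ME a (w - stepVec (0, true)) (0, true)
  have h2 := hΛ.EQ a (w - stepVec (0, true)) (0, true)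
  rw [sub_add_cancel] at h1 h2
  exact ⟨h1, h2⟩

end WF2

namespace WFS2

variable {P : PCells2} {Λ : ConcRadiiG} (hΛ : WFS2 P Λ)
include hΛ

/-- `ρ + 1 ≤ rB`. [folklore] -/
theorem ρB1 (a : ℕ) (v : Site 2) (δ : MDir) (ℓ : ℤ) : Λ.ρ a v δ ℓ + 1 ≤ Λ.rB a v δ :=
  (hΛ.ρE1 a v δ ℓ).trans ((Nat.le_succ _).trans (hΛ.EB1 a v δ))

/-- `ρ_{a'} + 1 ≤ rC_a` for an admissible `a'`. [folklore] -/
theorem ρC1 {a a' : ℕ} (v : Site 2) (δ : MDir) (ℓ : ℤ) (h : a' ∈ ({a, a + 1} : Finset ℕ)) : Λ.ρ a' v δ ℓ + 1 ≤ Λ.rC a v :=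
  (hΛ.ρB1 a' v δ ℓ).trans (hΛ.BC a a' v δ h)

end WFS2

section Records

variable (P : PCells2) (w₀ : V) {Λ : ConcRadiiG} (hΛ : WFS2 P Λ) (hφ : φ w₀ = 0)

/-! ## §3 `RunGeom`, `AnchGeom` -/

/-- **`RunGeom` — automatic for spans.** [folklore] -/
theorem runGeomSG : RunGeom G (cellGeomSG G φ P w₀ Λ) where
  adjQ _ _ _ hy := exists_adj_of_mem_VWin hy
  adjBtw _ _ _ _ hy := exists_adj_of_mem_VWin hy
  adjStub _ _ _ _ _ _ hy := exists_adj_of_mem_VStair hy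

/-- `AnchGeom`. [folklore] -/
theorem anchGeomSG : AnchGeom (cellGeomSG G φ P w₀ Λ) where
  refl a _ := Finset.mem_insert_self a {a + 1}
  const _ _ _ := rfl

/-! ## §4 `SepGeom`, `SepGeom₂` -/

include hΛ hφ in
/-- **`SepGeom`** (containments by monotonicity or the step device, disjointness and columns planar), under (ι) steps.
[cite: KozmaNitzan2024, §4 pp. 26–29] -/
theorem sepGeomSG (hstep : Steps G φ) : SepGeom G (cellGeomSG G φ P w₀ Λ) where
  anch_refl a _ := Finset.mem_insert_self a {a + 1}
  root_mem := by
    change w₀ ∈ VWin G φ w₀ (P.Q 0) (Λ.rQ 0 0)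
    refine root_mem_VWin hstep (le_trans (by omega) (hΛ.colQ 0 0)) (by rw [hφ]; exact P.zero_mem_Q_zero) (i := 0) (σ := 1) ?_
    rw [hφ]; exact P.single_mem_Q_zero
  Q_subset_Cell a v := VWin_mono (P.Q_subset_Cell v) (hΛ.QC a a v (ConcRadiiG.WF.mem_self a))
  Btw_subset_Cells a a' v δ ha' := by
    intro y hy
    change y ∈ VWin G φ w₀ (P.BtwN v δ) (Λ.rB a' v δ) at hy
    change y ∈ VWin G φ w₀ (P.Cell v) (Λ.rC a v) ∪ VWin G φ w₀ (P.Cell (v + stepVec δ)) (Λ.rC a' (v + stepVec δ))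
    have hd := mem_graphBall_of_mem_VWin hy
    rcases Finset.mem_union.1 (P.BtwN_subset_Cells v δ (φ_mem_of_mem_VWin hy)) with h | h
    · exact Finset.mem_union_left _ (mem_VWin_of_zdAdj hstep hd (hΛ.BC1 a a' v δ ha') h (P.exists_adj_of_mem_Cell v h))
    · exact Finset.mem_union_right _
        (mem_VWin_of_zdAdj hstep hd (hΛ.BC1' a' a' v δ (ConcRadiiG.WF.mem_self a')) h (P.exists_adj_of_mem_Cell _ h))
  Stub_subset_Q_union_Btw a a' v δ j ha' hj := by
    intro y hy
    change y ∈ VStair G φ w₀ (P.Stub v δ j) (prof P Λ a' v δ) at hy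
    change y ∈ VWin G φ w₀ (P.Q v) (Λ.rQ a v) ∪ VWin G φ w₀ (P.BtwN v δ) (Λ.rB a' v δ)
    obtain ⟨hP, hd⟩ := mem_of_mem_VStair hy
    have hjK : j < P.K := by change j + 1 ≤ P.K at hj; omega
    rcases Finset.mem_union.1 (P.Stub_subset_Q_union_BtwN v δ hjK hP) with h | h
    · exact Finset.mem_union_left _
        (mem_VWin_of_zdAdj hstep hd (hΛ.ρQ1 a a' v δ _ ha' (P.lev_le_of_mem_Q h)) h (P.exists_adj_of_mem_Q v h))
    · exact Finset.mem_union_right _ (mem_VWin_of_zdAdj hstep hd (hΛ.ρB1 a' v δ _) h (P.exists_adj_of_mem_BtwN v δ h))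
  Stub_subset_Cell_union_Zone a a' v δ j ha' hj := by
    intro y hy
    change y ∈ VStair G φ w₀ (P.Stub v δ j) (prof P Λ a' v δ) at hy
    change y ∈ VWin G φ w₀ (P.Cell v) (Λ.rC a v) ∪ VWin G φ w₀ (P.Zone v δ) (Λ.rB a' v δ)
    obtain ⟨hP, hd⟩ := mem_of_mem_VStair hy
    rcases Finset.mem_union.1 (P.Stub_subset_Cell_union_Zone v δ (by change j + 1 ≤ P.K at hj; omega) hP) with h | h
    · exact Finset.mem_union_left _ (mem_VWin_of_zdAdj hstep hd (hΛ.ρC1 v δ _ ha') h (P.exists_adj_of_mem_Cell v h))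
    · exact Finset.mem_union_right _ (mem_VWin_of_zdAdj hstep hd (hΛ.ρB1 a' v δ _) h (P.exists_adj_of_mem_Zone v δ h))
  Efar_subset_Btw_union_Q a v δ := by
    intro y hy
    change y ∈ VWin G φ w₀ (P.EfarN v δ) (Λ.rE a v δ) at hy
    change y ∈ VWin G φ w₀ (P.BtwN v δ) (Λ.rB a v δ) ∪ VWin G φ w₀ (P.Q (v + stepVec δ)) (Λ.rQ a (v + stepVec δ))
    have hd := mem_graphBall_of_mem_VWin hy
    rcases Finset.mem_union.1 (P.EfarN_subset_BtwN_union_Q v δ (φ_mem_of_mem_VWin hy)) with h | h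
    · exact Finset.mem_union_left _ (mem_VWin_of_zdAdj hstep hd (hΛ.EB1 a v δ) h (P.exists_adj_of_mem_BtwN v δ h))
    · exact Finset.mem_union_right _ (mem_VWin_of_zdAdj hstep hd (hΛ.EQ1 a v δ) h (P.exists_adj_of_mem_Q _ h))
  Ewv_disjoint_Efar a a' w δw du hdu := by
    change Disjoint (VWin G φ w₀ (P.BtwN w δw) (Λ.rB a w δw) ∪ VWin G φ w₀ (P.Q (w + stepVec δw)) (Λ.rQ a (w + stepVec δw)))
      (VWin G φ w₀ (P.EfarN (w + stepVec δw) du) (Λ.rE a' (w + stepVec δw) du))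
    have h := P.EwvN_disjoint_EfarN w hdu
    rw [PCells2.EwvN, Finset.disjoint_union_left] at h
    rw [Finset.disjoint_union_left]
    exact ⟨disjoint_VWin h.1 _ _, disjoint_VWin h.2 _ _⟩
  Q_disjoint_Q a a' u x hux := disjoint_VWin (P.Q_disjoint_Q hux) _ _
  Q_disjoint_Btw a a' x v δ := disjoint_VWin (P.Q_disjoint_BtwN x v δ) _ _
  Btw_disjoint_Btw a a' v δ v' δ' h1 h2 := disjoint_VWin (P.BtwN_disjoint_BtwN h1 h2) _ _
  Q_disjoint_Efar a a' v δ := disjoint_VWin (P.Q_disjoint_EfarN v δ) _ _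
  Btw_disjoint_Efar a a' v δ δ' h := disjoint_VWin (P.BtwN_disjoint_EfarN v h) _ _
  col_Q a x := by
    change ∃ y ∈ VWin G φ w₀ (P.Q x) (Λ.rQ a x), φ y = P.cen x
    refine exists_mem_VWin_φ_eq hstep (P.cen_mem_Q x) (i := 0) (σ := 1) (P.cen_add_single_mem_Q x) ?_
    rw [hφ, Pi.zero_apply, Pi.zero_apply, sub_zero, sub_zero]; exact hΛ.colQ a x
  col_Cell a u x hux y hy hcol := by
    change φ y = P.cen x at hcol
    exact P.cen_not_mem_Cell hux (hcol ▸ φ_mem_of_mem_VWin hy)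
  col_Zone a u δ x y hy hcol := by
    change φ y = P.cen x at hcol
    exact P.cen_not_mem_Zone u δ x (hcol ▸ φ_mem_of_mem_VWin hy)

include hΛ hφ in
/-- **`SepGeom₂`** (cross-anchor containments), under (ι) steps. [cite: KozmaNitzan2024, §4 pp. 25–26] -/
theorem sepGeom₂SG (hstep : Steps G φ) : SepGeom₂ G (cellGeomSG G φ P w₀ Λ) where
  toSepGeom := sepGeomSG P w₀ hΛ hφ hstep
  Q_subset_Cell₂ a a' x ha' := VWin_mono (P.Q_subset_Cell x) (hΛ.QC a a' x ha')
  Btw_subset_Cells₂ a a' v δ ha' := by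
    intro y hy
    change y ∈ VWin G φ w₀ (P.BtwN v δ) (Λ.rB a v δ) at hy
    change y ∈ VWin G φ w₀ (P.Cell v) (Λ.rC a v) ∪ VWin G φ w₀ (P.Cell (v + stepVec δ)) (Λ.rC a' (v + stepVec δ))
    have hd := mem_graphBall_of_mem_VWin hy
    rcases Finset.mem_union.1 (P.BtwN_subset_Cells v δ (φ_mem_of_mem_VWin hy)) with h | h
    · exact Finset.mem_union_left _
        (mem_VWin_of_zdAdj hstep hd (hΛ.BC1 a a v δ (ConcRadiiG.WF.mem_self a)) h (P.exists_adj_of_mem_Cell v h))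
    · exact Finset.mem_union_right _ (mem_VWin_of_zdAdj hstep hd (hΛ.BC1' a a' v δ ha') h (P.exists_adj_of_mem_Cell _ h))

end Records

end Skelφ

end Transplant

end Summit.CriticalPhenomena.PercolationContinuityZ3.Theorems

end
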